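import Mathlib
import Summits.AtomisticToContinuum.Crystallization.Theorems.PhononSlackCertificatesPeriodicGivenLayered
import Literature.Geometry.DiscreteGeometry.KissingPatterns

/-!
# Box pinning, part A: sites, the two lower bounds, the in-plane form, the count and the gap on indices

Support for the registered stubs `stub_geometricBounds` / `stub_boxPinning` of line `Sketch` of the crux
`GappedShellCensus.CleanLimitsHaveWindows` (stmt-AtomisticToContinuum-15932). For an exactly layered set
`Z = v + A(S(a', s, z))` (in-plane spacing `a' > 0`, Hägg word `s`, strictly increasing heights `z`):

* sites `bpSite`, membership (`bp_mem_iff`), distances as norms of `layerVec`s (`bp_dist_site`, `bp_norm_sq`);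
* the two lower bounds from the gap clause: `bp_inplane_lower` (`a(1 - 1/50) ≤ a'`, the in-plane neighbour is a
  point of `Z` at distance `a'`) and `bp_interlayer_lower` (`(a(1 - 1/50))² ≤ a'²/3 + (z(m+1) - z m)²`);
* the integer in-plane form `bpF δ i j = 3(2i + j + δ)² + (3j + δ)²` (`a'² F/12` = squared in-plane norm): its values
  are `0, 4, 12` or `≥ 16` (`bpF_trichotomy`), with the solution sets of `F = 0` (aligned site), `F = 4` (the block
  `bpBlock (δ/3)`), `F = 12, δ = 0` (the six neighbours `bpHex`);
* index-level bookkeeping: difference vectors `bpVec`, injectivity of the site map, the bond shell as the image of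
  the index shell, hence the count (`bp_countI`) and the gap clause (`bp_gapI`) on indices; the index shells
  `bpJ` and their polar/tropical, above/below parts (used in part C).
-/

noncomputable section

namespace Summit.AtomisticToContinuum.Crystallization.Theorems.CleanHull

open Filter Literature.MathematicalPhysics.StatisticalMechanics Literature.Geometry.DiscreteGeometry

/-! ## Sites of the translated layered set -/

/-- The site `(m, i, j)` of the translated layered set `v + A(S(a', s, z))`:
`A (i u + j v + L(m) w + z(m) e₃) + v`. [folklore] -/
def bpSite (A : EuclideanSpace ℝ (Fin 3) →ₗᵢ[ℝ] EuclideanSpace ℝ (Fin 3)) (a' : ℝ) (s : ℤ → ℤ)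
    (z : ℤ → ℝ) (v : EuclideanSpace ℝ (Fin 3)) (t : ℤ × ℤ × ℤ) : EuclideanSpace ℝ (Fin 3) :=
  A (layerVec a' (z t.1) (haggLabel s t.1) 1 t.2.1 t.2.2) + v

/-- Membership in the translated layered set: its points are exactly the sites. [folklore] -/
theorem bp_mem_iff {A : EuclideanSpace ℝ (Fin 3) →ₗᵢ[ℝ] EuclideanSpace ℝ (Fin 3)} {a' : ℝ} {s : ℤ → ℤ}
    {z : ℤ → ℝ} {v : EuclideanSpace ℝ (Fin 3)} {Z : Set (EuclideanSpace ℝ (Fin 3))}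
    (hZ : Z = (fun p => p + v) '' {p : EuclideanSpace ℝ (Fin 3) | ∃ m i j : ℤ,
        p = A (((i : ℝ) • triangularVec₁ a') + ((j : ℝ) • triangularVec₂ a') +
          ((haggLabel s m : ℝ) • barlowOffset a') + (z m • layerNormal 1))})
    {w : EuclideanSpace ℝ (Fin 3)} : w ∈ Z ↔ ∃ t : ℤ × ℤ × ℤ, w = bpSite A a' s z v t := by
  subst hZ
  constructor
  · rintro ⟨p, ⟨m, i, j, rfl⟩, rfl⟩
    exact ⟨(m, i, j), by rw [LayeredHull.cake_pt_eq_layerVec]; rfl⟩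
  · rintro ⟨⟨m, i, j⟩, rfl⟩
    exact ⟨_, ⟨m, i, j, rfl⟩, by rw [LayeredHull.cake_pt_eq_layerVec]; rfl⟩

/-- Sites are points of the set. [folklore] -/
theorem bp_site_mem {A : EuclideanSpace ℝ (Fin 3) →ₗᵢ[ℝ] EuclideanSpace ℝ (Fin 3)} {a' : ℝ} {s : ℤ → ℤ}
    {z : ℤ → ℝ} {v : EuclideanSpace ℝ (Fin 3)} {Z : Set (EuclideanSpace ℝ (Fin 3))}
    (hZ : Z = (fun p => p + v) '' {p : EuclideanSpace ℝ (Fin 3) | ∃ m i j : ℤ,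
        p = A (((i : ℝ) • triangularVec₁ a') + ((j : ℝ) • triangularVec₂ a') +
          ((haggLabel s m : ℝ) • barlowOffset a') + (z m • layerNormal 1))})
    (t : ℤ × ℤ × ℤ) : bpSite A a' s z v t ∈ Z :=
  (bp_mem_iff hZ).2 ⟨t, rfl⟩

/-- Distances between sites are norms of `layerVec`s of the differences. [folklore] -/
theorem bp_dist_site (A : EuclideanSpace ℝ (Fin 3) →ₗᵢ[ℝ] EuclideanSpace ℝ (Fin 3)) (a' : ℝ) (s : ℤ → ℤ)
    (z : ℤ → ℝ) (v : EuclideanSpace ℝ (Fin 3)) (t t' : ℤ × ℤ × ℤ) :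
    dist (bpSite A a' s z v t) (bpSite A a' s z v t') =
      ‖layerVec a' (z t'.1 - z t.1) (haggLabel s t'.1 - haggLabel s t.1) 1 (t'.2.1 - t.2.1) (t'.2.2 - t.2.2)‖ := by
  simp only [bpSite]
  rw [dist_add_right, LinearIsometry.dist_map, dist_comm, dist_eq_norm, LayeredHull.cake_layerVec_sub]

/-- The squared norm of `layerVec a H δ 1 p q` through the integer in-plane form
`3 (2p + q + δ)² + (3q + δ)²`. [folklore] -/
theorem bp_norm_sq (a H : ℝ) (δ p q : ℤ) :
    ‖layerVec a H δ 1 p q‖ ^ 2 =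
      a ^ 2 / 12 * (3 * (2 * (p : ℝ) + q + δ) ^ 2 + (3 * (q : ℝ) + δ) ^ 2) + H ^ 2 := by
  rw [LayeredHull.cake_norm_layerVec_sq]
  ring

/-! ## The two lower bounds from the gap clause -/

/-- **In-plane lower bound.** If `Z = v + A(S(a', s, z))` (`a' > 0`) satisfies the gap clause at scale `a`
(distinct points are `≥ a(1 - 1/50)` apart), then `a (1 - 1/50) ≤ a'`: the in-plane neighbour `(0, 1, 0)` of
the site `(0, 0, 0)` is at distance exactly `a'`. [folklore] -/
theorem bp_inplane_lower {A : EuclideanSpace ℝ (Fin 3) →ₗᵢ[ℝ] EuclideanSpace ℝ (Fin 3)} {a a' : ℝ}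
    {s : ℤ → ℤ} {z : ℤ → ℝ} {v : EuclideanSpace ℝ (Fin 3)} {Z : Set (EuclideanSpace ℝ (Fin 3))}
    (ha' : 0 < a')
    (hZ : Z = (fun p => p + v) '' {p : EuclideanSpace ℝ (Fin 3) | ∃ m i j : ℤ,
        p = A (((i : ℝ) • triangularVec₁ a') + ((j : ℝ) • triangularVec₂ a') +
          ((haggLabel s m : ℝ) • barlowOffset a') + (z m • layerNormal 1))})
    (hgap : ∀ y ∈ Z, ∀ w ∈ Z, w ≠ y → a * (1 - 1 / 50) ≤ dist y w) :
    a * (1 - 1 / 50) ≤ a' := by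
  have hd : dist (bpSite A a' s z v (0, 0, 0)) (bpSite A a' s z v (0, 1, 0)) = a' := by
    rw [bp_dist_site]
    have h2 : ‖layerVec a' (z 0 - z 0) (haggLabel s 0 - haggLabel s 0) 1 (1 - 0) (0 - 0)‖ ^ 2 = a' ^ 2 := by
      rw [bp_norm_sq]; push_cast; ring
    exact (pow_left_inj₀ (norm_nonneg _) ha'.le two_ne_zero).1 h2
  have hne : bpSite A a' s z v (0, 1, 0) ≠ bpSite A a' s z v (0, 0, 0) := by
    intro h
    have : dist (bpSite A a' s z v (0, 0, 0)) (bpSite A a' s z v (0, 1, 0)) = 0 := by rw [h, dist_self]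
    linarith
  have := hgap _ (bp_site_mem hZ (0, 0, 0)) _ (bp_site_mem hZ (0, 1, 0)) hne
  linarith

/-- The squared distance between the sites `(m, 0, 0)` and `(m + 1, 0, 0)` is `a'²/3 + (z (m+1) - z m)²`
(Hägg step `s m = ±1`). [folklore] -/
theorem bp_dist_succ_sq (A : EuclideanSpace ℝ (Fin 3) →ₗᵢ[ℝ] EuclideanSpace ℝ (Fin 3)) (a' : ℝ) {s : ℤ → ℤ}
    (hs : IsHaggSeq s) (z : ℤ → ℝ) (v : EuclideanSpace ℝ (Fin 3)) (m : ℤ) :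
    dist (bpSite A a' s z v (m, 0, 0)) (bpSite A a' s z v (m + 1, 0, 0)) ^ 2 =
      a' ^ 2 / 3 + (z (m + 1) - z m) ^ 2 := by
  rw [bp_dist_site, bp_norm_sq]
  have hs2 : ((s m : ℝ)) ^ 2 = 1 := by
    rcases hs m with h | h <;> simp [h]
  simp only [haggLabel_succ, add_sub_cancel_left, sub_self]
  push_cast
  linear_combination (a' ^ 2 / 3) * hs2

/-- **Interlayer lower bound.** Under the gap clause, `(a (1 - 1/50))² ≤ a'²/3 + (z (m+1) - z m)²` for every
`m` (`a ≥ 0`): the nearest point of the next layer is a point of `Z`. [folklore] -/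
theorem bp_interlayer_lower {A : EuclideanSpace ℝ (Fin 3) →ₗᵢ[ℝ] EuclideanSpace ℝ (Fin 3)} {a a' : ℝ}
    {s : ℤ → ℤ} {z : ℤ → ℝ} {v : EuclideanSpace ℝ (Fin 3)} {Z : Set (EuclideanSpace ℝ (Fin 3))}
    (ha : 0 ≤ a) (ha' : 0 < a') (hs : IsHaggSeq s)
    (hZ : Z = (fun p => p + v) '' {p : EuclideanSpace ℝ (Fin 3) | ∃ m i j : ℤ,
        p = A (((i : ℝ) • triangularVec₁ a') + ((j : ℝ) • triangularVec₂ a') +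
          ((haggLabel s m : ℝ) • barlowOffset a') + (z m • layerNormal 1))})
    (hgap : ∀ y ∈ Z, ∀ w ∈ Z, w ≠ y → a * (1 - 1 / 50) ≤ dist y w) (m : ℤ) :
    (a * (1 - 1 / 50)) ^ 2 ≤ a' ^ 2 / 3 + (z (m + 1) - z m) ^ 2 := by
  have hd := bp_dist_succ_sq A a' hs z v m
  have hne : bpSite A a' s z v (m + 1, 0, 0) ≠ bpSite A a' s z v (m, 0, 0) := by
    intro h
    have h0 : dist (bpSite A a' s z v (m, 0, 0)) (bpSite A a' s z v (m + 1, 0, 0)) = 0 := by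
      rw [h, dist_self]
    rw [h0] at hd
    nlinarith [sq_nonneg (z (m + 1) - z m)]
  have h1 := hgap _ (bp_site_mem hZ (m, 0, 0)) _ (bp_site_mem hZ (m + 1, 0, 0)) hne
  have h0 : 0 ≤ a * (1 - 1 / 50) := by positivity
  rw [← hd]
  exact pow_le_pow_left₀ h0 h1 2

/-! ## The integer in-plane form -/

/-- The integer in-plane form `F(δ, i, j) = 3 (2i + j + δ)² + (3j + δ)²`: `a² F / 12` is the squared norm of the
in-plane vector `i u + j v + δ w`. [folklore] -/
def bpF (δ i j : ℤ) : ℤ := 3 * (2 * i + j + δ) ^ 2 + (3 * j + δ) ^ 2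

/-- The values of the in-plane form: `0`, `4`, `12` or `≥ 16` (`2i + j + δ ≡ 3j + δ (mod 2)`). [folklore] -/
theorem bpF_trichotomy (δ i j : ℤ) :
    bpF δ i j = 0 ∨ bpF δ i j = 4 ∨ bpF δ i j = 12 ∨ 16 ≤ bpF δ i j := by
  unfold bpF
  have hpar : (2 * i + j + δ) - (3 * j + δ) = 2 * (i - j) := by ring
  generalize 2 * i + j + δ = P at hpar ⊢
  generalize 3 * j + δ = Q at hpar ⊢
  rcases le_or_gt 3 |P| with h | h
  · right; right; right; nlinarith [sq_abs P, sq_nonneg Q, abs_nonneg P]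
  rcases le_or_gt 4 |Q| with h' | h'
  · right; right; right; nlinarith [sq_abs Q, sq_nonneg P, abs_nonneg Q]
  obtain ⟨hP1, hP2⟩ := abs_lt.1 h
  obtain ⟨hQ1, hQ2⟩ := abs_lt.1 h'
  interval_cases P <;> interval_cases Q <;> omega

/-- `F = 0` only at the aligned site `(i, j) = (-δ/3, -δ/3)`, `3 ∣ δ`. [folklore] -/
theorem bpF_eq_zero {δ i j : ℤ} (h : bpF δ i j = 0) : i = -(δ / 3) ∧ j = -(δ / 3) ∧ δ % 3 = 0 := by
  unfold bpF at h
  have hP : 2 * i + j + δ = 0 := by nlinarith [sq_nonneg (2 * i + j + δ), sq_nonneg (3 * j + δ)]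
  have hQ : 3 * j + δ = 0 := by nlinarith [sq_nonneg (2 * i + j + δ), sq_nonneg (3 * j + δ)]
  omega

/-- `F = 4` only for `3 ∤ δ` and `(i, j)` in the `2 × 2` block `{-δ/3 - 1, -δ/3}²` (the three nearest sites of
a laterally shifted layer lie in this block). [folklore] -/
theorem bpF_eq_four {δ i j : ℤ} (h : bpF δ i j = 4) :
    (i = -(δ / 3) ∨ i = -(δ / 3) - 1) ∧ (j = -(δ / 3) ∨ j = -(δ / 3) - 1) ∧ δ % 3 ≠ 0 := by
  unfold bpF at h
  have hpar : (2 * i + j + δ) - (3 * j + δ) = 2 * (i - j) := by ring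
  generalize hP : 2 * i + j + δ = P at hpar h
  generalize hQ : 3 * j + δ = Q at hpar h
  have h1 : |P| < 2 := by
    by_contra hc
    have hc' := not_lt.1 hc
    nlinarith [sq_abs P, sq_nonneg Q, abs_nonneg P]
  have h2 : |Q| < 3 := by
    by_contra hc
    have hc' := not_lt.1 hc
    nlinarith [sq_abs Q, sq_nonneg P, abs_nonneg Q]
  obtain ⟨hP1, hP2⟩ := abs_lt.1 h1
  obtain ⟨hQ1, hQ2⟩ := abs_lt.1 h2
  interval_cases P <;> interval_cases Q <;> omega

/-- The six in-layer neighbours `(±1, 0), (0, ±1), ±(1, -1)`. [folklore] -/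
def bpHex : Finset (ℤ × ℤ) := {(1, 0), (-1, 0), (0, 1), (0, -1), (1, -1), (-1, 1)}

/-- The `2 × 2` block of sites `{-e - 1, -e}²`. [folklore] -/
def bpBlock (e : ℤ) : Finset (ℤ × ℤ) := {(-e, -e), (-e - 1, -e), (-e, -e - 1), (-e - 1, -e - 1)}

/-- `#bpHex ≤ 6`. [folklore] -/
theorem card_bpHex_le : bpHex.card ≤ 6 := Finset.card_le_six

/-- `#bpBlock e ≤ 4`. [folklore] -/
theorem card_bpBlock_le (e : ℤ) : (bpBlock e).card ≤ 4 := Finset.card_le_four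

/-- In-layer (`δ = 0`) vectors with `F = 12` are the six neighbours. [folklore] -/
theorem bpF_zero_eq_twelve {i j : ℤ} (h : bpF 0 i j = 12) : (i, j) ∈ bpHex := by
  unfold bpF at h
  have h1 : |2 * i + j| < 3 := by
    by_contra hc
    have hc' := not_lt.1 hc
    nlinarith [sq_abs (2 * i + j), sq_nonneg (3 * j), abs_nonneg (2 * i + j)]
  have h2 : |j| < 2 := by
    by_contra hc
    have hc' := not_lt.1 hc
    nlinarith [sq_abs j, sq_nonneg (2 * i + j + 0), abs_nonneg j]
  obtain ⟨hP1, hP2⟩ := abs_lt.1 h1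
  obtain ⟨hQ1, hQ2⟩ := abs_lt.1 h2
  have hi : -2 ≤ i ∧ i ≤ 2 := by constructor <;> omega
  obtain ⟨hi1, hi2⟩ := hi
  simp only [bpHex, Finset.mem_insert, Finset.mem_singleton, Prod.mk.injEq]
  interval_cases i <;> interval_cases j <;> omega

/-- Sites with `F = 4` lie in the block `bpBlock (δ / 3)`. [folklore] -/
theorem mem_bpBlock_of_bpF_eq_four {δ i j : ℤ} (h : bpF δ i j = 4) : (i, j) ∈ bpBlock (δ / 3) := by
  obtain ⟨hi, hj, -⟩ := bpF_eq_four h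
  simp only [bpBlock, Finset.mem_insert, Finset.mem_singleton, Prod.mk.injEq]
  rcases hi with hi | hi <;> rcases hj with hj | hj <;> simp [hi, hj]

/-! ## Index-level bookkeeping: difference vectors, injectivity, the gap clause and the count on indices -/

/-- The difference vector from site `t` to site `t'` (before the isometry). [folklore] -/
def bpVec (a' : ℝ) (s : ℤ → ℤ) (z : ℤ → ℝ) (t t' : ℤ × ℤ × ℤ) : EuclideanSpace ℝ (Fin 3) :=
  layerVec a' (z t'.1 - z t.1) (haggLabel s t'.1 - haggLabel s t.1) 1 (t'.2.1 - t.2.1) (t'.2.2 - t.2.2)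

/-- `dist (site t) (site t') = ‖bpVec t t'‖`. [folklore] -/
theorem bp_dist_eq_norm_bpVec (A : EuclideanSpace ℝ (Fin 3) →ₗᵢ[ℝ] EuclideanSpace ℝ (Fin 3)) (a' : ℝ)
    (s : ℤ → ℤ) (z : ℤ → ℝ) (v : EuclideanSpace ℝ (Fin 3)) (t t' : ℤ × ℤ × ℤ) :
    dist (bpSite A a' s z v t) (bpSite A a' s z v t') = ‖bpVec a' s z t t'‖ :=
  bp_dist_site A a' s z v t t'

/-- The squared norm of the difference vector: `a'² F / 12 + H²`. [folklore] -/
theorem bp_normSq_bpVec (a' : ℝ) (s : ℤ → ℤ) (z : ℤ → ℝ) (t t' : ℤ × ℤ × ℤ) :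
    ‖bpVec a' s z t t'‖ ^ 2 = a' ^ 2 / 12 *
        (bpF (haggLabel s t'.1 - haggLabel s t.1) (t'.2.1 - t.2.1) (t'.2.2 - t.2.2) : ℝ) +
      (z t'.1 - z t.1) ^ 2 := by
  unfold bpVec bpF
  rw [bp_norm_sq]
  push_cast
  ring

/-- The site map is injective (`a' ≠ 0`, strictly increasing heights). [folklore] -/
theorem bp_site_injective (A : EuclideanSpace ℝ (Fin 3) →ₗᵢ[ℝ] EuclideanSpace ℝ (Fin 3)) {a' : ℝ}
    (ha' : a' ≠ 0) (s : ℤ → ℤ) {z : ℤ → ℝ} (hz : StrictMono z) (v : EuclideanSpace ℝ (Fin 3)) :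
    Function.Injective (bpSite A a' s z v) := by
  intro t t' h
  simp only [bpSite, add_left_inj] at h
  have h' := A.injective h
  obtain ⟨h1, h2, h3⟩ := LayeredHull.cake_param_injective a' ha' (haggLabel s) z hz.injective h'
  ext <;> assumption

/-- The bond shell of the site `t₀` is the image of the index shell. [folklore] -/
theorem bp_shell_eq_image {A : EuclideanSpace ℝ (Fin 3) →ₗᵢ[ℝ] EuclideanSpace ℝ (Fin 3)} {a' : ℝ}
    {s : ℤ → ℤ} {z : ℤ → ℝ} {v : EuclideanSpace ℝ (Fin 3)} {Z : Set (EuclideanSpace ℝ (Fin 3))}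
    (ha' : a' ≠ 0) (hz : StrictMono z)
    (hZ : Z = (fun p => p + v) '' {p : EuclideanSpace ℝ (Fin 3) | ∃ m i j : ℤ,
        p = A (((i : ℝ) • triangularVec₁ a') + ((j : ℝ) • triangularVec₂ a') +
          ((haggLabel s m : ℝ) • barlowOffset a') + (z m • layerNormal 1))})
    (t₀ : ℤ × ℤ × ℤ) (r : ℝ) :
    {w ∈ Z | w ≠ bpSite A a' s z v t₀ ∧ dist (bpSite A a' s z v t₀) w ≤ r} =
      bpSite A a' s z v '' {t | t ≠ t₀ ∧ ‖bpVec a' s z t₀ t‖ ≤ r} := by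
  ext w
  simp only [Set.mem_setOf_eq, Set.mem_image]
  constructor
  · rintro ⟨hw, hne, hd⟩
    obtain ⟨t, rfl⟩ := (bp_mem_iff hZ).1 hw
    refine ⟨t, ⟨fun h => hne (by rw [h]), ?_⟩, rfl⟩
    rwa [bp_dist_eq_norm_bpVec] at hd
  · rintro ⟨t, ⟨hne, hd⟩, rfl⟩
    refine ⟨bp_site_mem hZ t, fun h => hne (bp_site_injective A ha' s hz v h), ?_⟩
    rwa [bp_dist_eq_norm_bpVec]

/-- **The count on indices.** If every site has exactly twelve other points of `Z` within `r`, then for every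
index `t₀` exactly twelve indices `t ≠ t₀` have `‖bpVec t₀ t‖ ≤ r`. [folklore] -/
theorem bp_countI {A : EuclideanSpace ℝ (Fin 3) →ₗᵢ[ℝ] EuclideanSpace ℝ (Fin 3)} {a' : ℝ}
    {s : ℤ → ℤ} {z : ℤ → ℝ} {v : EuclideanSpace ℝ (Fin 3)} {Z : Set (EuclideanSpace ℝ (Fin 3))}
    (ha' : a' ≠ 0) (hz : StrictMono z)
    (hZ : Z = (fun p => p + v) '' {p : EuclideanSpace ℝ (Fin 3) | ∃ m i j : ℤ,
        p = A (((i : ℝ) • triangularVec₁ a') + ((j : ℝ) • triangularVec₂ a') +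
          ((haggLabel s m : ℝ) • barlowOffset a') + (z m • layerNormal 1))})
    {r : ℝ} (hcount : ∀ y ∈ Z, {w ∈ Z | w ≠ y ∧ dist y w ≤ r}.ncard = 12) (t₀ : ℤ × ℤ × ℤ) :
    {t : ℤ × ℤ × ℤ | t ≠ t₀ ∧ ‖bpVec a' s z t₀ t‖ ≤ r}.ncard = 12 := by
  have h := hcount _ (bp_site_mem hZ t₀)
  rwa [bp_shell_eq_image ha' hz hZ, Set.ncard_image_of_injective _ (bp_site_injective A ha' s hz v)] at h

/-! ## Index shells and their polar / tropical parts -/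

/-- The index shell of the site `(m, 0, 0)`: indices `t ≠ (m, 0, 0)` with `‖bpVec (m,0,0) t‖ ≤ a(1 + 1/50)`.
[folklore] -/
def bpJ (a a' : ℝ) (s : ℤ → ℤ) (z : ℤ → ℝ) (m : ℤ) : Set (ℤ × ℤ × ℤ) :=
  {t | t ≠ (m, 0, 0) ∧ ‖bpVec a' s z (m, 0, 0) t‖ ≤ a * (1 + 1 / 50)}

/-- Polar part of the index shell above `m`: in-plane form `0` (sites vertically above `(m, 0, 0)`).
[folklore] -/
def bpJPp (a a' : ℝ) (s : ℤ → ℤ) (z : ℤ → ℝ) (m : ℤ) : Set (ℤ × ℤ × ℤ) :=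
  {t | t ∈ bpJ a a' s z m ∧ m < t.1 ∧ bpF (haggLabel s t.1 - haggLabel s m) t.2.1 t.2.2 = 0}

/-- Polar part of the index shell below `m`. [folklore] -/
def bpJPn (a a' : ℝ) (s : ℤ → ℤ) (z : ℤ → ℝ) (m : ℤ) : Set (ℤ × ℤ × ℤ) :=
  {t | t ∈ bpJ a a' s z m ∧ t.1 < m ∧ bpF (haggLabel s t.1 - haggLabel s m) t.2.1 t.2.2 = 0}

/-- Tropical part of the index shell above `m`: in-plane form `4` (laterally shifted layers). [folklore] -/
def bpJBp (a a' : ℝ) (s : ℤ → ℤ) (z : ℤ → ℝ) (m : ℤ) : Set (ℤ × ℤ × ℤ) :=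
  {t | t ∈ bpJ a a' s z m ∧ m < t.1 ∧ bpF (haggLabel s t.1 - haggLabel s m) t.2.1 t.2.2 = 4}

/-- Tropical part of the index shell below `m`. [folklore] -/
def bpJBn (a a' : ℝ) (s : ℤ → ℤ) (z : ℤ → ℝ) (m : ℤ) : Set (ℤ × ℤ × ℤ) :=
  {t | t ∈ bpJ a a' s z m ∧ t.1 < m ∧ bpF (haggLabel s t.1 - haggLabel s m) t.2.1 t.2.2 = 4}

/-- **The gap clause on indices.** [folklore] -/
theorem bp_gapI {A : EuclideanSpace ℝ (Fin 3) →ₗᵢ[ℝ] EuclideanSpace ℝ (Fin 3)} {a a' : ℝ}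
    {s : ℤ → ℤ} {z : ℤ → ℝ} {v : EuclideanSpace ℝ (Fin 3)} {Z : Set (EuclideanSpace ℝ (Fin 3))}
    (ha' : a' ≠ 0) (hz : StrictMono z)
    (hZ : Z = (fun p => p + v) '' {p : EuclideanSpace ℝ (Fin 3) | ∃ m i j : ℤ,
        p = A (((i : ℝ) • triangularVec₁ a') + ((j : ℝ) • triangularVec₂ a') +
          ((haggLabel s m : ℝ) • barlowOffset a') + (z m • layerNormal 1))})
    (hgap : ∀ y ∈ Z, ∀ w ∈ Z, w ≠ y → a * (1 - 1 / 50) ≤ dist y w ∧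
      (dist y w ≤ a * (1 + 1 / 50) ∨ a * (63 / 50) ≤ dist y w))
    {t t' : ℤ × ℤ × ℤ} (hne : t ≠ t') :
    a * (1 - 1 / 50) ≤ ‖bpVec a' s z t t'‖ ∧
      (‖bpVec a' s z t t'‖ ≤ a * (1 + 1 / 50) ∨ a * (63 / 50) ≤ ‖bpVec a' s z t t'‖) := by
  have h := hgap _ (bp_site_mem hZ t) _ (bp_site_mem hZ t')
    fun h => hne (bp_site_injective A ha' s hz v h).symm
  rwa [bp_dist_eq_norm_bpVec] at h

end Summit.AtomisticToContinuum.Crystallization.Theorems.CleanHull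

end
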